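import Literature.NumberTheory.GaloisRepresentations.LocalFrobeniusDensity
import Mathlib.NumberTheory.Padics.PadicIntegers
import Mathlib.Analysis.Normed.Field.Basic
import HarnessLib

/-!
# Two UNRAMIFIED characters of a local Galois group: if `δ(σ) = 1` then `ν(σ) = 0`, as soon as the Frobenius value `δ(Frob)`
# separates `p`-adic exponents (density of `⟨Frob⟩·I`; proofs only)

Topic `NumberTheory/GaloisRepresentations` (namespace `Literature.NumberTheory.GaloisRepresentations.IsNonarchimedeanLocalField`).
THEOREMS ONLY (no definition, no named fact; D-0026). For a non-archimedean local field `F`, an arithmetic Frobenius `σ₀`, a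
continuous UNRAMIFIED additive character `ν : Γ_F → ℤ_p` and a continuous UNRAMIFIED multiplicative character `δ : Γ_F → L`
(`L` a normed field) whose Frobenius value `α = δ(σ₀)` SEPARATES EXPONENTS — `α^{a_m} → 1` for natural numbers `a_m` forces
`a_m → 0` in `ℤ_p` (true for a `p`-adic unit which is not a root of unity) — every `σ` with `δ(σ) = 1` has `ν(σ) = 0`:
by the density of `⟨σ₀⟩·I_F` (tree `exists_forall_smul_eq_pow_and_mem`, Serre *Local Fields* IV §4 Cor. 2) `σ = σ₀^{a_m} u_m` with
`u_m → ` the common kernel, so `α^{a_m} = δ(u_m)⁻¹ → 1`, `a_m → 0`, and `ν(σ) = a_m ν(σ₀) + ν(u_m) → 0`.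

Use (cell `bsd-stepL`, crux 25505, stub (FIX), memo `LOCALDEFECT-25505-imc-p1-g23.md` step (4')): `δ` = the unramified quotient
character of the ordinary frame (`δ(Frob) = α_p`, the unit root [Wiles88 Thm 2.2]; `α_p` no root of unity [Deligne]),
`ν = κ(τ₁)·κ' − κ'(τ₁)·κ` for an inertia element `τ₁` (unramified by the proportionality of `ℤ_p`-characters on inertia,
`toAdd_mul_comm_of_mem_inertia_of_ncard_primesOver_eq`); for `σ₁ ∈ ker κ ∖ ker κ'`, `ν(σ₁) = κ(τ₁)κ'(σ₁) ≠ 0`, hence `δ(σ₁) ≠ 1`.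

* `toAdd_eq_zero_of_unramified_of_apply_eq_one` — the statement above.

References: [SerreLocalFields1979] Ch. IV §4 Cor. 2 to Prop. 16 (`Gal(K_nr/K) = Ẑ`, generated by Frobenius).
-/

noncomputable section

open Filter Topology ValuativeRel Field
open scoped Pointwise

namespace Literature.NumberTheory.GaloisRepresentations
namespace IsNonarchimedeanLocalField

variable {F : Type*} [Field F] [ValuativeRel F] [TopologicalSpace F] [IsNonarchimedeanLocalField F]

/-- **`δ(σ) = 1 ⟹ ν(σ) = 0` for unramified characters with exponent-separating Frobenius value.** `ν : Γ_F →ₜ* ℤ_p` (additive,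
written multiplicatively) and `δ : Γ_F →* L` continuous, both trivial on the inertia group, `σ₀` an arithmetic Frobenius with
`(δ σ₀)^{a_m} → 1 ⟹ a_m → 0` in `ℤ_p` for sequences of naturals; then `δ σ = 1 → ν σ = 0`.
[cite: SerreLocalFields1979, Ch. IV §4 Cor. 2 to Prop. 16] -/
theorem toAdd_eq_zero_of_unramified_of_apply_eq_one {p : ℕ} [Fact p.Prime]
    {σ₀ : absoluteGaloisGroup F} (hσ₀ : IsAbsArithFrob σ₀)
    (ν : absoluteGaloisGroup F →ₜ* Multiplicative ℤ_[p]) (hνI : ∀ τ ∈ absInertia F, ν τ = 1)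
    {L : Type*} [NormedField L] (δ : absoluteGaloisGroup F →* L) (hδc : Continuous δ)
    (hδI : ∀ τ ∈ absInertia F, δ τ = 1)
    (hα : ∀ a : ℕ → ℕ, Tendsto (fun m ↦ (δ σ₀) ^ (a m)) atTop (𝓝 1) →
      Tendsto (fun m ↦ ((a m : ℕ) : ℤ_[p])) atTop (𝓝 0))
    {σ : absoluteGaloisGroup F} (hσ : δ σ = 1) : (ν σ).toAdd = 0 := by
  -- shrinking open neighbourhoods of the inertia group
  let ε : ℕ → ℝ := fun m ↦ 1 / ((m : ℝ) + 1)
  have hε : ∀ m, 0 < ε m := fun m ↦ by positivity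
  have hε0 : Tendsto ε atTop (𝓝 0) := tendsto_one_div_add_atTop_nhds_zero_nat
  let U : ℕ → Set (absoluteGaloisGroup F) := fun m ↦
    {τ | ‖(ν τ).toAdd‖ < ε m ∧ ‖δ τ - 1‖ < ε m}
  have hνc : Continuous fun τ ↦ (ν τ).toAdd := continuous_toAdd.comp (map_continuous ν)
  have hUo : ∀ m, IsOpen (U m) := fun m ↦
    (isOpen_lt (continuous_norm.comp hνc) continuous_const).inter
      (isOpen_lt (continuous_norm.comp (hδc.sub continuous_const)) continuous_const)
  have hUI : ∀ m, (absInertia F : Set (absoluteGaloisGroup F)) ⊆ U m := fun m τ hτ ↦ by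
    refine ⟨?_, ?_⟩
    · show ‖(ν τ).toAdd‖ < ε m
      rw [hνI τ hτ, toAdd_one, norm_zero]; exact hε m
    · show ‖δ τ - 1‖ < ε m
      rw [hδI τ hτ, sub_self, norm_zero]; exact hε m
  -- density: `σ = σ₀^{a m} · u m` with `u m ∈ U m`
  have hdens : ∀ m, ∃ a : ℕ, (σ₀ ^ a)⁻¹ * σ ∈ U m := fun m ↦ by
    obtain ⟨a, -, ha⟩ := exists_forall_smul_eq_pow_and_mem hσ₀ σ ∅ (by simp) (hUo m) (hUI m)
    exact ⟨a, ha⟩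
  choose a ha using hdens
  have hσeq : ∀ m, σ = σ₀ ^ a m * ((σ₀ ^ a m)⁻¹ * σ) := fun m ↦ by rw [mul_inv_cancel_left]
  -- `δ`: `α^{a m} = (δ (u m))⁻¹ → 1`
  have hδu : Tendsto (fun m ↦ δ ((σ₀ ^ a m)⁻¹ * σ)) atTop (𝓝 1) := by
    rw [tendsto_iff_norm_sub_tendsto_zero]
    refine squeeze_zero (fun m ↦ norm_nonneg _) (fun m ↦ (ha m).2.le) hε0
  have hαpow : ∀ m, (δ σ₀) ^ (a m) = (δ ((σ₀ ^ a m)⁻¹ * σ))⁻¹ := fun m ↦ by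
    have h := congrArg δ (hσeq m)
    rw [hσ, map_mul, map_pow] at h
    -- `1 = α^a * δ u`
    have hu0 : δ ((σ₀ ^ a m)⁻¹ * σ) ≠ 0 := by
      intro h0; rw [h0, mul_zero] at h; exact one_ne_zero h
    exact (eq_inv_of_mul_eq_one_left h.symm)
  have hαt : Tendsto (fun m ↦ (δ σ₀) ^ (a m)) atTop (𝓝 1) := by
    have h := hδu.inv₀ one_ne_zero
    rw [inv_one] at h
    exact h.congr fun m ↦ (hαpow m).symm
  have hat : Tendsto (fun m ↦ ((a m : ℕ) : ℤ_[p])) atTop (𝓝 0) := hα a hαt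
  -- `ν`: `ν σ = a m • ν σ₀ + ν (u m) → 0`
  have hνeq : ∀ m, (ν σ).toAdd = ((a m : ℕ) : ℤ_[p]) * (ν σ₀).toAdd + (ν ((σ₀ ^ a m)⁻¹ * σ)).toAdd := fun m ↦ by
    have h : ν σ = ν (σ₀ ^ a m) * ν ((σ₀ ^ a m)⁻¹ * σ) := by rw [← map_mul, mul_inv_cancel_left]
    rw [map_pow] at h
    have h' := congrArg Multiplicative.toAdd h
    rwa [toAdd_mul, toAdd_pow, nsmul_eq_mul] at h'
  have hνu : Tendsto (fun m ↦ (ν ((σ₀ ^ a m)⁻¹ * σ)).toAdd) atTop (𝓝 0) := by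
    rw [tendsto_zero_iff_norm_tendsto_zero]
    exact squeeze_zero (fun m ↦ norm_nonneg _) (fun m ↦ (ha m).1.le) hε0
  have hlim : Tendsto (fun m ↦ ((a m : ℕ) : ℤ_[p]) * (ν σ₀).toAdd + (ν ((σ₀ ^ a m)⁻¹ * σ)).toAdd)
      atTop (𝓝 0) := by
    have h := (hat.mul_const (ν σ₀).toAdd).add hνu
    rwa [zero_mul, zero_add] at h
  have hconst : Tendsto (fun _ : ℕ ↦ (ν σ).toAdd) atTop (𝓝 0) := hlim.congr fun m ↦ (hνeq m).symm
  exact tendsto_nhds_unique tendsto_const_nhds hconst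

end IsNonarchimedeanLocalField
end Literature.NumberTheory.GaloisRepresentations

end
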